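import Literature.AlgebraicGeometry.Motives.MixedHodgeStructureCatDualFunctor
import Literature.AlgebraicGeometry.Motives.MixedHodgeStructureCatWeightGradedObjectSplitOverQ
import Literature.AlgebraicGeometry.Motives.MixedHodgeStructureCatTateTwist
import Mathlib.CategoryTheory.Abelian.SerreClass.Basic
import HarnessLib

/-!
# Finite-dimensional mixed Hodge structures form a Hom-finite Serre subcategory of `MixedHodgeStructureCat`

Layer `Literature/AlgebraicGeometry/Motives` (lane `lit-hodgefound`).  Continuation of g45-#10 (`Motives/MixedHodgeStructureCatDualFunctor`: the object
property `isFinite X :↔ Module.Finite ℚ X` and the full subcategory `FinSubcategory`).  The finite-dimensional mixed Hodge structures — the ones of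
Hodge theory proper (Deligne's MHS are on finite-type modules; Cattani–El Zein–Griffiths–Lê Def. 3.2.14 ∕ Thm. 3.2.18) — are closed under every
construction of the lane:

* §1 **`isFinite` is a Serre class** of the abelian category `MixedHodgeStructureCat` (Mathlib `ObjectProperty.IsSerreClass`): closed under
  subobjects, quotients, extensions (`isFinite_of_shortExact`: in `0 → X₁ → X₂ → X₃ → 0` exact, `X₂` is finite-dimensional iff `X₁` and `X₃` are),
  contains `0`; hence kernels, cokernels, images of morphisms between finite-dimensional objects are finite-dimensional;
* §2 closed under the lane's functors: binary and finite direct sums (`prodObj`, `X ⨯ Y`, `X ⊞ Y`, `piObj`, `⨁ F`), Tate twists, duals (g45-#10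
  `isFinite_dual`), the total graded `grTotal s`, underlying objects of subobjects;
* §3 **Hom-finiteness**: `Hom(X, Y)` is a finite-dimensional `ℚ`-vector space for `X, Y` finite-dimensional (it embeds `ℚ`-linearly in
  `Hom_ℚ(X, Y)`), with **`finrank ℚ (X ⟶ Y) ≤ dim X · dim Y`**; in particular `End X` is finite-dimensional, so `FinSubcategory` is a Hom-finite
  `ℚ`-linear category all of whose objects have the Krull–Schmidt property (the tree's `krullRemakSchmidt`, g43-#4).

Everything is PROVED; no named fact, no instance (class-valued statements are theorems), no notation (data: the linear map `toLinearMapₗ`).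

Sources, verbatim (through the tree's files).  E. Cattani, F. El Zein, P. A. Griffiths, Lê D. T. (eds.), *Hodge Theory* (2014) [CattaniElZeinGriffithsLe2014],
Def. 3.2.14 (MHS on a finitely generated module), **Thm. 3.2.18** «The category of mixed Hodge structures is abelian» (kernels and cokernels are computed on
the underlying vector spaces, Lemma 3.2.20), Ex. 3.2.23 (2) (direct sums).  P. Deligne, *Théorie de Hodge II* (1971) [DeligneHodgeII1971], 2.3.1, Thm. 2.3.5.
J.-P. Serre's notion of a class of objects closed under subobjects, quotients and extensions is Mathlib's `ObjectProperty.IsSerreClass`.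

## Main results

* §1 `isFinite_of_shortExact`, `isFinite_iff_of_shortExact`, `isFinite_isClosedUnderSubobjects`, `isFinite_isClosedUnderQuotients`, `isFinite_containsZero`,
  `isFinite_isClosedUnderExtensions`, **`isFinite_isSerreClass`**, `isFinite_of_isZero`, `isFinite_kernel`, `isFinite_cokernel`, `isFinite_image_of_src`,
  `isFinite_image_of_tgt`, `isFinite_subobject`.
* §2 `isFinite_prodObj`, `isFinite_prod`, `isFinite_biprod`, `isFinite_piObj`, `isFinite_biproduct`, `isFinite_tateTwist_obj`, `isFinite_tateTwist_obj_iff`,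
  `isFinite_grTotal_obj`.
* §3 `toLinearMapₗ`, `toLinearMapₗ_apply`, `toLinearMapₗ_injective`, **`finite_hom`**, **`finrank_hom_le`**, `finite_end`, `isArtinianRing_end`,
  `finite_hom_finSubcategory`.

## References

* [CattaniElZeinGriffithsLe2014] E. Cattani et al. (eds.), Hodge Theory, Princeton Math. Notes 49 (2014), Def. 3.2.14, Thm. 3.2.18, Lemma 3.2.20, Ex. 3.2.23 (2).
* [DeligneHodgeII1971] P. Deligne, Théorie de Hodge II, Publ. Math. IHÉS 40 (1971), 2.3.1, Thm. 2.3.5.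

## Provenance

Lane `lit-hodgefound` (summit `HodgeConjecture`), seat `lit-hodgefound-p36` (literature-prover, generation 45, row g45-#12).
-/

noncomputable section

open CategoryTheory CategoryTheory.Limits

namespace Literature.AlgebraicGeometry.Motives

universe u

namespace MixedHodgeStructureCat

/-! ## §1 `isFinite` is a Serre class -/

section Serre

/-- **Extensions of finite-dimensional MHS are finite-dimensional**: in a short exact sequence `0 → X₁ → X₂ → X₃ → 0` with `X₁, X₃` finite-dimensional,
`X₂` is finite-dimensional (exactness holds on the underlying vector spaces). [cite: CattaniElZeinGriffithsLe2014, Thm. 3.2.18] [cite: DeligneHodgeII1971, Thm. 2.3.5] -/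
theorem isFinite_of_shortExact {C : ShortComplex MixedHodgeStructureCat.{u}} (hC : C.ShortExact) (h₁ : isFinite C.X₁) (h₃ : isFinite C.X₃) :
    isFinite C.X₂ := by
  haveI : Module.Finite ℚ C.X₁ := h₁
  haveI : Module.Finite ℚ C.X₃ := h₃
  obtain ⟨-, hg, hfg⟩ := (shortExact_iff C).1 hC
  rw [isFinite_iff, Module.finite_def]
  apply Submodule.fg_of_fg_map_of_fg_inf_ker C.g.toLinearMap
  · rw [Submodule.map_top, LinearMap.range_eq_top.2 hg]
    exact Module.finite_def.1 inferInstance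
  · rw [top_inf_eq, LinearMap.exact_iff.1 hfg, LinearMap.range_eq_map]
    exact (Module.finite_def.1 inferInstance).map _

/-- In a short exact sequence `0 → X₁ → X₂ → X₃ → 0`: `X₂` is finite-dimensional iff `X₁` and `X₃` are. [cite: CattaniElZeinGriffithsLe2014, Thm. 3.2.18] -/
theorem isFinite_iff_of_shortExact {C : ShortComplex MixedHodgeStructureCat.{u}} (hC : C.ShortExact) : isFinite C.X₂ ↔ isFinite C.X₁ ∧ isFinite C.X₃ := by
  haveI := hC.mono_f
  haveI := hC.epi_g
  exact ⟨fun h => ⟨isFinite_of_mono C.f h, isFinite_of_epi C.g h⟩, fun h => isFinite_of_shortExact hC h.1 h.2⟩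

/-- `isFinite` is closed under subobjects (Mathlib `ObjectProperty.IsClosedUnderSubobjects`). [cite: CattaniElZeinGriffithsLe2014, Thm. 3.2.18 and Lemma 3.2.20] -/
theorem isFinite_isClosedUnderSubobjects : isFinite.{u}.IsClosedUnderSubobjects where
  prop_of_mono f _ hY := isFinite_of_mono f hY

/-- `isFinite` is closed under quotients (Mathlib `ObjectProperty.IsClosedUnderQuotients`). [cite: CattaniElZeinGriffithsLe2014, Thm. 3.2.18 and Lemma 3.2.20] -/
theorem isFinite_isClosedUnderQuotients : isFinite.{u}.IsClosedUnderQuotients where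
  prop_of_epi f _ hX := isFinite_of_epi f hX

/-- A zero object is finite-dimensional. [cite: CattaniElZeinGriffithsLe2014, Thm. 3.2.18] -/
theorem isFinite_of_isZero {X : MixedHodgeStructureCat.{u}} (hX : IsZero X) : isFinite X :=
  isFinite_of_iso (hX.iso isZero_zero).symm (inferInstanceAs (Module.Finite ℚ PUnit.{u + 1}))

/-- `isFinite` contains a zero object (Mathlib `ObjectProperty.ContainsZero`). [cite: CattaniElZeinGriffithsLe2014, Thm. 3.2.18] -/
theorem isFinite_containsZero : isFinite.{u}.ContainsZero where
  exists_zero := ⟨zero, isZero_zero, isFinite_of_isZero isZero_zero⟩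

/-- `isFinite` is closed under extensions (Mathlib `ObjectProperty.IsClosedUnderExtensions`). [cite: CattaniElZeinGriffithsLe2014, Thm. 3.2.18] -/
theorem isFinite_isClosedUnderExtensions : isFinite.{u}.IsClosedUnderExtensions where
  prop_X₂_of_shortExact hC h₁ h₃ := isFinite_of_shortExact hC h₁ h₃

/-- **The finite-dimensional mixed Hodge structures form a Serre subcategory of `MixedHodgeStructureCat`** (Mathlib `ObjectProperty.IsSerreClass`).
[cite: CattaniElZeinGriffithsLe2014, Thm. 3.2.18] [cite: DeligneHodgeII1971, Thm. 2.3.5] -/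
theorem isFinite_isSerreClass : isFinite.{u}.IsSerreClass :=
  haveI := isFinite_isClosedUnderSubobjects.{u}
  haveI := isFinite_isClosedUnderQuotients.{u}
  haveI := isFinite_containsZero.{u}
  haveI := isFinite_isClosedUnderExtensions.{u}
  {}

/-- The kernel of a morphism out of a finite-dimensional object is finite-dimensional. [cite: CattaniElZeinGriffithsLe2014, Lemma 3.2.20] -/
theorem isFinite_kernel {X Y : MixedHodgeStructureCat.{u}} (f : X ⟶ Y) (hX : isFinite X) : isFinite (kernel f) :=
  isFinite_of_mono (kernel.ι f) hX

/-- The cokernel of a morphism into a finite-dimensional object is finite-dimensional. [cite: CattaniElZeinGriffithsLe2014, Lemma 3.2.20] -/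
theorem isFinite_cokernel {X Y : MixedHodgeStructureCat.{u}} (f : X ⟶ Y) (hY : isFinite Y) : isFinite (cokernel f) :=
  isFinite_of_epi (cokernel.π f) hY

/-- The image of a morphism out of a finite-dimensional object is finite-dimensional. [cite: CattaniElZeinGriffithsLe2014, Lemma 3.2.20] -/
theorem isFinite_image_of_src {X Y : MixedHodgeStructureCat.{u}} (f : X ⟶ Y) (hX : isFinite X) : isFinite (image f) :=
  isFinite_of_epi (factorThruImage f) hX

/-- The image of a morphism into a finite-dimensional object is finite-dimensional. [cite: CattaniElZeinGriffithsLe2014, Lemma 3.2.20] -/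
theorem isFinite_image_of_tgt {X Y : MixedHodgeStructureCat.{u}} (f : X ⟶ Y) (hY : isFinite Y) : isFinite (image f) :=
  isFinite_of_mono (image.ι f) hY

/-- The object underlying a subobject of a finite-dimensional object is finite-dimensional. [cite: CattaniElZeinGriffithsLe2014, Lemma 3.2.20] -/
theorem isFinite_subobject {X : MixedHodgeStructureCat.{u}} (S : Subobject X) (hX : isFinite X) : isFinite (S : MixedHodgeStructureCat.{u}) :=
  isFinite_of_mono S.arrow hX

end Serre

/-! ## §2 Closure under direct sums, Tate twists, duals, `grTotal` -/

section Constructions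

/-- The product MHS `prodObj X Y` of finite-dimensional objects is finite-dimensional. [cite: CattaniElZeinGriffithsLe2014, Ex. 3.2.23 (2)] -/
theorem isFinite_prodObj {X Y : MixedHodgeStructureCat.{u}} (hX : isFinite X) (hY : isFinite Y) : isFinite (prodObj X Y) :=
  haveI : Module.Finite ℚ X := hX
  haveI : Module.Finite ℚ Y := hY
  inferInstanceAs (Module.Finite ℚ (X × Y))

/-- The categorical product `X ⨯ Y` of finite-dimensional objects is finite-dimensional. [cite: CattaniElZeinGriffithsLe2014, Ex. 3.2.23 (2)] -/
theorem isFinite_prod {X Y : MixedHodgeStructureCat.{u}} (hX : isFinite X) (hY : isFinite Y) : isFinite (X ⨯ Y) :=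
  isFinite_of_iso (prodIsoProdObj X Y).symm (isFinite_prodObj hX hY)

/-- The biproduct `X ⊞ Y` of finite-dimensional objects is finite-dimensional. [cite: CattaniElZeinGriffithsLe2014, Thm. 3.2.18 and Ex. 3.2.23 (2)] -/
theorem isFinite_biprod {X Y : MixedHodgeStructureCat.{u}} [HasBinaryBiproduct X Y] (hX : isFinite X) (hY : isFinite Y) : isFinite (X ⊞ Y) :=
  isFinite_of_iso ((biprod.isoProd X Y).trans (prodIsoProdObj X Y)).symm (isFinite_prodObj hX hY)

/-- The product MHS `piObj F` of a finite family of finite-dimensional objects is finite-dimensional. [cite: CattaniElZeinGriffithsLe2014, Ex. 3.2.23 (2)] -/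
theorem isFinite_piObj {J : Type} [Fintype J] [DecidableEq J] (F : J → MixedHodgeStructureCat.{u}) (hF : ∀ j, isFinite (F j)) : isFinite (piObj F) :=
  haveI : ∀ j, Module.Finite ℚ (F j) := hF
  finite_piObj F

/-- The biproduct `⨁ F` of a finite family of finite-dimensional objects is finite-dimensional. [cite: CattaniElZeinGriffithsLe2014, Thm. 3.2.18 and Ex. 3.2.23 (2)] -/
theorem isFinite_biproduct [HasFiniteBiproducts MixedHodgeStructureCat.{u}] {J : Type} [Fintype J] [DecidableEq J] (F : J → MixedHodgeStructureCat.{u})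
    (hF : ∀ j, isFinite (F j)) : isFinite (⨁ F) :=
  isFinite_of_iso (biproductIsoPiObj F).symm (isFinite_piObj F hF)

/-- Tate twists of finite-dimensional objects are finite-dimensional (same underlying space). [cite: DeligneHodgeII1971, 2.3.1] -/
theorem isFinite_tateTwist_obj (j : ℤ) {X : MixedHodgeStructureCat.{u}} (hX : isFinite X) : isFinite ((tateTwist j).obj X) := hX

/-- `X(j)` is finite-dimensional iff `X` is. [cite: DeligneHodgeII1971, 2.3.1] -/
theorem isFinite_tateTwist_obj_iff (j : ℤ) (X : MixedHodgeStructureCat.{u}) : isFinite ((tateTwist j).obj X) ↔ isFinite X := Iff.rfl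

/-- The total graded `(grTotal s) X = ⨁_{n ∈ s} Gr^W_n X` of a finite-dimensional object is finite-dimensional. [cite: CattaniElZeinGriffithsLe2014, Ex. 3.2.23 (2)] -/
theorem isFinite_grTotal_obj [HasFiniteBiproducts MixedHodgeStructureCat.{u}] (s : Finset ℤ) {X : MixedHodgeStructureCat.{u}} (hX : isFinite X) :
    isFinite ((grTotal s).obj X) :=
  haveI : Module.Finite ℚ X := hX
  finite_grTotal_obj s X

end Constructions

/-! ## §3 Hom-finiteness -/

section HomFinite

variable (X Y : MixedHodgeStructureCat.{u})

/-- `f ↦ f` (underlying linear map) as a `ℚ`-linear map `Hom(X, Y) → Hom_ℚ(X, Y)`. [cite: CattaniElZeinGriffithsLe2014, Thm. 3.2.18] [cite: DeligneHodgeII1971, 2.3.1] -/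
def toLinearMapₗ : (X ⟶ Y) →ₗ[ℚ] (X →ₗ[ℚ] Y) where
  toFun f := f.toLinearMap
  map_add' _ _ := rfl
  map_smul' _ _ := rfl

/-- Unfolding `toLinearMapₗ`. [cite: CattaniElZeinGriffithsLe2014, Thm. 3.2.18] -/
theorem toLinearMapₗ_apply (f : X ⟶ Y) : toLinearMapₗ X Y f = f.toLinearMap := rfl

/-- A morphism of MHS is determined by its underlying linear map: `toLinearMapₗ` is injective. [cite: DeligneHodgeII1971, 2.3.1] -/
theorem toLinearMapₗ_injective : Function.Injective (toLinearMapₗ X Y) := fun _ _ h => hom_ext h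

/-- **`Hom(X, Y)` is finite-dimensional over `ℚ`** for finite-dimensional `X`, `Y`. [cite: CattaniElZeinGriffithsLe2014, Thm. 3.2.18] [cite: DeligneHodgeII1971, 2.3.1] -/
theorem finite_hom [Module.Finite ℚ X] [Module.Finite ℚ Y] : Module.Finite ℚ (X ⟶ Y) :=
  FiniteDimensional.of_injective (toLinearMapₗ X Y) (toLinearMapₗ_injective X Y)

/-- **`dim_ℚ Hom(X, Y) ≤ dim X · dim Y`.** [cite: CattaniElZeinGriffithsLe2014, Thm. 3.2.18] [cite: DeligneHodgeII1971, 2.3.1] -/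
theorem finrank_hom_le [Module.Finite ℚ X] [Module.Finite ℚ Y] : Module.finrank ℚ (X ⟶ Y) ≤ Module.finrank ℚ X * Module.finrank ℚ Y := by
  rw [← Module.finrank_linearMap (R := ℚ) (S := ℚ) (M := X) (N := Y)]
  exact LinearMap.finrank_le_finrank_of_injective (toLinearMapₗ_injective X Y)

/-- `End X` is finite-dimensional over `ℚ` for finite-dimensional `X`. [cite: CattaniElZeinGriffithsLe2014, Thm. 3.2.18] -/
theorem finite_end [Module.Finite ℚ X] : Module.Finite ℚ (End X) :=
  finite_hom X X

/-- `End X` is an artinian ring for finite-dimensional `X` (a finite-dimensional `ℚ`-algebra) — the standing hypothesis `[IsArtinianRing (End X)]` of the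
tree's categorical Krull–Schmidt files (`CategoryTheory/Preadditive/KrullSchmidt*`). [cite: CattaniElZeinGriffithsLe2014, Thm. 3.2.18 and p. 270] -/
theorem isArtinianRing_end [Module.Finite ℚ X] : IsArtinianRing (End X) :=
  haveI := finite_end X
  IsArtinianRing.of_finite ℚ (End X)

/-- Hom-spaces of `FinSubcategory` are finite-dimensional over `ℚ`. [cite: CattaniElZeinGriffithsLe2014, Thm. 3.2.18] -/
theorem finite_hom_finSubcategory (A B : FinSubcategory.{u}) : Module.Finite ℚ (A ⟶ B) :=
  haveI : Module.Finite ℚ A.obj := A.property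
  haveI : Module.Finite ℚ B.obj := B.property
  haveI := finite_hom A.obj B.obj
  FiniteDimensional.of_injective
    ({ toFun := fun f => f.hom, map_add' := fun _ _ => rfl, map_smul' := fun _ _ => rfl } : (A ⟶ B) →ₗ[ℚ] (A.obj ⟶ B.obj))
    (fun _ _ h => isFinite.hom_ext h)

end HomFinite

end MixedHodgeStructureCat

end Literature.AlgebraicGeometry.Motives
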